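import Summits.QuantumFields.YangMills.Theorems.LuscherReductionTwistedTraceScalingPolarMean
import Literature.Algebra.EuclideanLattices.ShortVectorBoxFinThree
import HarnessLib

/-!
# LINEARISATION of a near-identity link under a near-identity gauge transformation, in orthographic (vector-part) coordinates, with an explicit
# quadratic remainder: `(P(ξ)·P(w)·P(ζ)⁻¹)⃗ = w + ξ − ζ + R`, `‖R‖∞ ≤ 40(g² + g‖w‖∞)`, `g = max(‖ξ‖∞, ‖ζ‖∞)`
# (the core algebraic lemma of the Faddeev–Popov weight asymptotics (N1)/(N2); lane A of S-BASE, crux `TwistedTraceScaling` stmt-QuantumFields-20203, C4 INNER;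
# design note `pub/ym-fleet/ym-luscher-20007-p1/COARSE-DESIGN.md` §23.6 (C))

For `h_x = P(ξ) = chartSU2 ξ`, a link `W_e = P(w)` and `h_y = P(ζ)` (all in the upper cap, sup-norms `≤ 1/4`), the transformed link `h_x W_e h_y⁻¹` has vector part
* EXACTLY (★ `vecPart_conj_chart`): `−(am − ξ·w)ζ + b(a w + m ξ + ξ×w) − (a w + m ξ + ξ×w)×ζ` with `a = √(1−|ξ|²)`, `m = √(1−|w|²)`, `b = √(1−|ζ|²)`
  (`vecPart_mul`, `scalarPart_mul`, `vecPart_inv`, `scalarPart_inv`, `vecPart_chartSU2`, `scalarPart_chartSU2`);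
* hence (★★ `norm_vecPart_conj_chart_sub_linear_le`): `‖(h_x W_e h_y⁻¹)⃗ − (w + ξ − ζ)‖∞ ≤ 40·(g² + g·‖w‖∞)`, `g = max(‖ξ‖∞, ‖ζ‖∞)` — every remainder term carries a
  gauge factor, so at `ξ = ζ = 0` the coordinate is exactly `w` and the FIRST-ORDER effect of the gauge action is the lattice gradient `ξ_x − ξ_y = −(vacGrad ξ)_e`.
Tools: `one_sub_le_sqrt_one_sub` (`1 − x ≤ √(1−x)` on `[0,1]`), sup-norm bounds for `⬝ᵥ` (`abs_dotProduct_le_three`) and `⨯₃` (`norm_cross_le_two`).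
Summing over the sites of a direction and dividing by the polar mean (second order, because `Σ_x (ξ_x − ξ_{x+k}) = 0` on the torus and `w` is balanced) gives the
linearisation of `relLinkVec` used in §23.6 (C) — sequel.
HONEST FRAMING: elementary quaternion algebra for a stub of a child of the CONDITIONAL reduction route R2b1; no kernel estimate; C4 OPEN; not a gap, not Clay.
-/

set_option autoImplicit false

noncomputable section

open Real
open scoped BigOperators Matrix
open Literature.MathematicalPhysics.QuantumFieldTheory
open Literature.MathematicalPhysics.QuantumLattice

namespace Summit.QuantumFields.YangMills.Theorems.FemtoTransferGap.TwoLattice.ConstTube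

open Summit.QuantumFields.YangMills.Theorems.FemtoTransferGap
open Summit.QuantumFields.YangMills.Theorems.FemtoTransferGap.TwoLattice.Cov (scalarPart_inv vecPart_inv)
open Literature.Algebra.EuclideanLattices (abs_apply_le_norm)

/-! ## §1 Sup-norm toolkit on `ℝ³` -/

/-- `Σ_a v_a² ≤ 3‖v‖∞²`. [folklore] -/
theorem sum_sq_le_three_norm_sq (v : Fin 3 → ℝ) : ∑ a, v a ^ 2 ≤ 3 * ‖v‖ ^ 2 := by
  have h : ∀ a, v a ^ 2 ≤ ‖v‖ ^ 2 := fun a => by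
    have := abs_apply_le_norm v a
    rw [← sq_abs]; exact pow_le_pow_left₀ (abs_nonneg _) this 2
  calc ∑ a, v a ^ 2 ≤ ∑ _a : Fin 3, ‖v‖ ^ 2 := Finset.sum_le_sum fun a _ => h a
    _ = 3 * ‖v‖ ^ 2 := by rw [Finset.sum_const, Finset.card_univ, Fintype.card_fin, nsmul_eq_mul]; norm_num

/-- `|v·w| ≤ 3‖v‖∞‖w‖∞`. [folklore] -/
theorem abs_dotProduct_le_three (v w : Fin 3 → ℝ) : |v ⬝ᵥ w| ≤ 3 * (‖v‖ * ‖w‖) := by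
  unfold dotProduct
  calc |∑ a, v a * w a| ≤ ∑ a, |v a * w a| := Finset.abs_sum_le_sum_abs _ _
    _ ≤ ∑ _a : Fin 3, ‖v‖ * ‖w‖ := Finset.sum_le_sum fun a _ => by
        rw [abs_mul]; exact mul_le_mul (abs_apply_le_norm v a) (abs_apply_le_norm w a) (abs_nonneg _) (norm_nonneg _)
    _ = 3 * (‖v‖ * ‖w‖) := by rw [Finset.sum_const, Finset.card_univ, Fintype.card_fin, nsmul_eq_mul]; norm_num

/-- `‖v × w‖∞ ≤ 2‖v‖∞‖w‖∞`. [folklore] -/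
theorem norm_cross_le_two (v w : Fin 3 → ℝ) : ‖v ⨯₃ w‖ ≤ 2 * (‖v‖ * ‖w‖) := by
  have hb : ∀ i j k l : Fin 3, |v i * w j - v k * w l| ≤ 2 * (‖v‖ * ‖w‖) := fun i j k l => by
    have h1 : |v i * w j| ≤ ‖v‖ * ‖w‖ := by
      rw [abs_mul]; exact mul_le_mul (abs_apply_le_norm v i) (abs_apply_le_norm w j) (abs_nonneg _) (norm_nonneg _)
    have h2 : |v k * w l| ≤ ‖v‖ * ‖w‖ := by
      rw [abs_mul]; exact mul_le_mul (abs_apply_le_norm v k) (abs_apply_le_norm w l) (abs_nonneg _) (norm_nonneg _)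
    calc |v i * w j - v k * w l| ≤ |v i * w j| + |v k * w l| := abs_sub _ _
      _ ≤ 2 * (‖v‖ * ‖w‖) := by linarith
  refine (pi_norm_le_iff_of_nonneg (by positivity)).mpr fun a => ?_
  rw [Real.norm_eq_abs, cross_apply]
  fin_cases a
  · exact hb 1 2 2 1
  · exact hb 2 0 0 2
  · exact hb 0 1 1 0

/-- `‖c • v‖∞ = |c|‖v‖∞`. [folklore] -/
theorem norm_smul_real (c : ℝ) (v : Fin 3 → ℝ) : ‖c • v‖ = |c| * ‖v‖ := by
  rw [norm_smul, Real.norm_eq_abs]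

/-- `1 − x ≤ √(1 − x)` for `0 ≤ x ≤ 1`. [folklore] -/
theorem one_sub_le_sqrt_one_sub {x : ℝ} (h0 : 0 ≤ x) (h1 : x ≤ 1) : 1 - x ≤ √(1 - x) := by
  have h : (1 - x) ^ 2 ≤ 1 - x := by nlinarith
  calc 1 - x = √((1 - x) ^ 2) := by rw [Real.sqrt_sq (by linarith)]
    _ ≤ √(1 - x) := Real.sqrt_le_sqrt h

/-- The scalar part of a cap point is close to `1`: `0 ≤ 1 − √(1 − Σv²) ≤ 3‖v‖∞²` (for `‖v‖∞ ≤ 1/2`). [folklore] -/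
theorem one_sub_sqrt_le {v : Fin 3 → ℝ} (hv : ‖v‖ ≤ 1 / 2) :
    0 ≤ 1 - √(1 - ∑ a, v a ^ 2) ∧ 1 - √(1 - ∑ a, v a ^ 2) ≤ 3 * ‖v‖ ^ 2 ∧ √(1 - ∑ a, v a ^ 2) ≤ 1 := by
  have hs := sum_sq_le_three_norm_sq v
  have hs1 : ∑ a, v a ^ 2 ≤ 1 := by nlinarith [norm_nonneg v]
  have hs0 : 0 ≤ ∑ a, v a ^ 2 := Finset.sum_nonneg fun a _ => sq_nonneg _
  have hle1 : √(1 - ∑ a, v a ^ 2) ≤ 1 := by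
    rw [show (1 : ℝ) = √1 from Real.sqrt_one.symm]
    exact Real.sqrt_le_sqrt (by rw [Real.sqrt_one]; linarith)
  refine ⟨by linarith, ?_, hle1⟩
  have := one_sub_le_sqrt_one_sub hs0 hs1
  linarith

/-! ## §2 The exact formula -/

/-- ★ **Exact vector part of `P(ξ)·P(w)·P(ζ)⁻¹`** (orthographic cap points, `Σ ≤ 1` each):
`−(am − ξ·w)ζ + b(a w + m ξ + ξ×w) − (a w + m ξ + ξ×w)×ζ`, `a = √(1−|ξ|²)`, `m = √(1−|w|²)`, `b = √(1−|ζ|²)`. [cite: BrockerTomDieck1985, I (1.10)] -/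
theorem vecPart_conj_chart {ξ w ζ : Fin 3 → ℝ} (hξ : ∑ a, ξ a ^ 2 ≤ 1) (hw : ∑ a, w a ^ 2 ≤ 1) (hζ : ∑ a, ζ a ^ 2 ≤ 1) :
    vecPart (chartSU2 ξ * chartSU2 w * (chartSU2 ζ)⁻¹) =
      -((√(1 - ∑ a, ξ a ^ 2) * √(1 - ∑ a, w a ^ 2) - ξ ⬝ᵥ w) • ζ) +
        √(1 - ∑ a, ζ a ^ 2) • (√(1 - ∑ a, ξ a ^ 2) • w + √(1 - ∑ a, w a ^ 2) • ξ + ξ ⨯₃ w) -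
        (√(1 - ∑ a, ξ a ^ 2) • w + √(1 - ∑ a, w a ^ 2) • ξ + ξ ⨯₃ w) ⨯₃ ζ := by
  have hs1 : scalarPart (chartSU2 ξ * chartSU2 w) = √(1 - ∑ a, ξ a ^ 2) * √(1 - ∑ a, w a ^ 2) - ξ ⬝ᵥ w := by
    rw [scalarPart_mul, scalarPart_chartSU2 hξ, scalarPart_chartSU2 hw, vecPart_chartSU2 hξ, vecPart_chartSU2 hw]
  have hv1 : vecPart (chartSU2 ξ * chartSU2 w) = √(1 - ∑ a, ξ a ^ 2) • w + √(1 - ∑ a, w a ^ 2) • ξ + ξ ⨯₃ w := by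
    rw [vecPart_mul, scalarPart_chartSU2 hξ, scalarPart_chartSU2 hw, vecPart_chartSU2 hξ, vecPart_chartSU2 hw]
  rw [vecPart_mul, scalarPart_inv, vecPart_inv, hs1, hv1, scalarPart_chartSU2 hζ, vecPart_chartSU2 hζ, smul_neg, LinearMap.map_neg]
  abel

/-! ## §3 ★★ The remainder bound -/
set_option maxHeartbeats 400000 in
/-- ★★ **Linearisation with quadratic remainder**: for `‖ξ‖∞, ‖w‖∞, ‖ζ‖∞ ≤ 1/4`,
`‖(P(ξ)P(w)P(ζ)⁻¹)⃗ − (w + ξ − ζ)‖∞ ≤ 40·(g² + g‖w‖∞)` with `g = max(‖ξ‖∞, ‖ζ‖∞)`. [folklore] -/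
theorem norm_vecPart_conj_chart_sub_linear_le {ξ w ζ : Fin 3 → ℝ} (hξ : ‖ξ‖ ≤ 1 / 4) (hw : ‖w‖ ≤ 1 / 4) (hζ : ‖ζ‖ ≤ 1 / 4) :
    ‖vecPart (chartSU2 ξ * chartSU2 w * (chartSU2 ζ)⁻¹) - (w + ξ - ζ)‖ ≤
      40 * (max ‖ξ‖ ‖ζ‖ ^ 2 + max ‖ξ‖ ‖ζ‖ * ‖w‖) := by
  -- smallness data
  obtain ⟨ha0, ha, ha1⟩ := one_sub_sqrt_le (v := ξ) (by linarith)
  obtain ⟨hm0, hm, hm1⟩ := one_sub_sqrt_le (v := w) (by linarith)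
  obtain ⟨hb0, hb, hb1⟩ := one_sub_sqrt_le (v := ζ) (by linarith)
  have ha_nn : 0 ≤ √(1 - ∑ i, ξ i ^ 2) := Real.sqrt_nonneg _
  have hm_nn : 0 ≤ √(1 - ∑ i, w i ^ 2) := Real.sqrt_nonneg _
  have hb_nn : 0 ≤ √(1 - ∑ i, ζ i ^ 2) := Real.sqrt_nonneg _
  set a := √(1 - ∑ i, ξ i ^ 2) with ha_def
  set m := √(1 - ∑ i, w i ^ 2) with hm_def
  set b := √(1 - ∑ i, ζ i ^ 2) with hb_def
  have hξ1 : ∑ i, ξ i ^ 2 ≤ 1 := by nlinarith [sum_sq_le_three_norm_sq ξ, norm_nonneg ξ]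
  have hw1 : ∑ i, w i ^ 2 ≤ 1 := by nlinarith [sum_sq_le_three_norm_sq w, norm_nonneg w]
  have hζ1 : ∑ i, ζ i ^ 2 ≤ 1 := by nlinarith [sum_sq_le_three_norm_sq ζ, norm_nonneg ζ]
  rw [vecPart_conj_chart hξ1 hw1 hζ1]
  set g := max ‖ξ‖ ‖ζ‖ with hg
  have hgξ : ‖ξ‖ ≤ g := le_max_left _ _
  have hgζ : ‖ζ‖ ≤ g := le_max_right _ _
  have hg0 : 0 ≤ g := (norm_nonneg ξ).trans hgξ
  have hw0 : 0 ≤ ‖w‖ := norm_nonneg w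
  have hξ0 : 0 ≤ ‖ξ‖ := norm_nonneg ξ
  have hζ0 : 0 ≤ ‖ζ‖ := norm_nonneg ζ
  have hg4 : g ≤ 1 / 4 := max_le hξ hζ
  -- regroup: exact − linear = T1 + T2 + T3 + T4 + T5
  set v1 := a • w + m • ξ + ξ ⨯₃ w with hv1
  have hdecomp : -((a * m - ξ ⬝ᵥ w) • ζ) + b • v1 - v1 ⨯₃ ζ - (w + ξ - ζ) =
      (1 - a * m + ξ ⬝ᵥ w) • ζ + (b * a - 1) • w + (b * m - 1) • ξ + b • (ξ ⨯₃ w) - v1 ⨯₃ ζ := by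
    rw [hv1]; module
  rw [hdecomp]
  -- bounds on the five terms
  have hdot : |ξ ⬝ᵥ w| ≤ 3 * (‖ξ‖ * ‖w‖) := abs_dotProduct_le_three ξ w
  have h1a : |1 - a| ≤ 3 * ‖ξ‖ ^ 2 := by rw [abs_of_nonneg ha0]; exact ha
  have h1m : |1 - m| ≤ 3 * ‖w‖ ^ 2 := by rw [abs_of_nonneg hm0]; exact hm
  have h1b : |1 - b| ≤ 3 * ‖ζ‖ ^ 2 := by rw [abs_of_nonneg hb0]; exact hb
  have hT1 : ‖(1 - a * m + ξ ⬝ᵥ w) • ζ‖ ≤ (3 * ‖ξ‖ ^ 2 + 3 * ‖w‖ ^ 2 + 3 * (‖ξ‖ * ‖w‖)) * ‖ζ‖ := by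
    rw [norm_smul_real]
    refine mul_le_mul_of_nonneg_right ?_ hζ0
    have e : 1 - a * m + ξ ⬝ᵥ w = (1 - a) + a * (1 - m) + ξ ⬝ᵥ w := by ring
    rw [e]
    calc |(1 - a) + a * (1 - m) + ξ ⬝ᵥ w| ≤ |1 - a| + |a * (1 - m)| + |ξ ⬝ᵥ w| :=
          (abs_add_le _ _).trans (by linarith [abs_add_le (1 - a) (a * (1 - m))])
      _ ≤ 3 * ‖ξ‖ ^ 2 + 3 * ‖w‖ ^ 2 + 3 * (‖ξ‖ * ‖w‖) := by
          have : |a * (1 - m)| ≤ 3 * ‖w‖ ^ 2 := by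
            rw [abs_mul, abs_of_nonneg ha_nn]
            calc a * |1 - m| ≤ 1 * |1 - m| := mul_le_mul_of_nonneg_right ha1 (abs_nonneg _)
              _ ≤ 3 * ‖w‖ ^ 2 := by rw [one_mul]; exact h1m
          linarith
  have hT2 : ‖(b * a - 1) • w‖ ≤ (3 * ‖ζ‖ ^ 2 + 3 * ‖ξ‖ ^ 2) * ‖w‖ := by
    rw [norm_smul_real]
    refine mul_le_mul_of_nonneg_right ?_ hw0
    have e : b * a - 1 = -((1 - b) + b * (1 - a)) := by ring
    rw [e, abs_neg]
    calc |(1 - b) + b * (1 - a)| ≤ |1 - b| + |b * (1 - a)| := abs_add_le _ _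
      _ ≤ 3 * ‖ζ‖ ^ 2 + 3 * ‖ξ‖ ^ 2 := by
          have : |b * (1 - a)| ≤ 3 * ‖ξ‖ ^ 2 := by
            rw [abs_mul, abs_of_nonneg hb_nn]
            calc b * |1 - a| ≤ 1 * |1 - a| := mul_le_mul_of_nonneg_right hb1 (abs_nonneg _)
              _ ≤ 3 * ‖ξ‖ ^ 2 := by rw [one_mul]; exact h1a
          linarith
  have hT3 : ‖(b * m - 1) • ξ‖ ≤ (3 * ‖ζ‖ ^ 2 + 3 * ‖w‖ ^ 2) * ‖ξ‖ := by
    rw [norm_smul_real]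
    refine mul_le_mul_of_nonneg_right ?_ hξ0
    have e : b * m - 1 = -((1 - b) + b * (1 - m)) := by ring
    rw [e, abs_neg]
    calc |(1 - b) + b * (1 - m)| ≤ |1 - b| + |b * (1 - m)| := abs_add_le _ _
      _ ≤ 3 * ‖ζ‖ ^ 2 + 3 * ‖w‖ ^ 2 := by
          have : |b * (1 - m)| ≤ 3 * ‖w‖ ^ 2 := by
            rw [abs_mul, abs_of_nonneg hb_nn]
            calc b * |1 - m| ≤ 1 * |1 - m| := mul_le_mul_of_nonneg_right hb1 (abs_nonneg _)
              _ ≤ 3 * ‖w‖ ^ 2 := by rw [one_mul]; exact h1m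
          linarith
  have hT4 : ‖b • (ξ ⨯₃ w)‖ ≤ 2 * (‖ξ‖ * ‖w‖) := by
    rw [norm_smul_real, abs_of_nonneg hb_nn]
    calc b * ‖ξ ⨯₃ w‖ ≤ 1 * ‖ξ ⨯₃ w‖ := mul_le_mul_of_nonneg_right hb1 (norm_nonneg _)
      _ ≤ 2 * (‖ξ‖ * ‖w‖) := by rw [one_mul]; exact norm_cross_le_two ξ w
  have hv1n : ‖v1‖ ≤ ‖w‖ + ‖ξ‖ + 2 * (‖ξ‖ * ‖w‖) := by
    rw [hv1]
    calc ‖a • w + m • ξ + ξ ⨯₃ w‖ ≤ ‖a • w‖ + ‖m • ξ‖ + ‖ξ ⨯₃ w‖ := norm_add₃_le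
      _ ≤ ‖w‖ + ‖ξ‖ + 2 * (‖ξ‖ * ‖w‖) := by
          rw [norm_smul_real, norm_smul_real, abs_of_nonneg ha_nn, abs_of_nonneg hm_nn]
          have h1 : a * ‖w‖ ≤ ‖w‖ := by nlinarith
          have h2 : m * ‖ξ‖ ≤ ‖ξ‖ := by nlinarith
          linarith [norm_cross_le_two ξ w]
  have hT5 : ‖v1 ⨯₃ ζ‖ ≤ 2 * ((‖w‖ + ‖ξ‖ + 2 * (‖ξ‖ * ‖w‖)) * ‖ζ‖) :=
    (norm_cross_le_two v1 ζ).trans (by nlinarith [norm_nonneg v1])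
  -- assemble: triangle inequality
  have hsum : ‖(1 - a * m + ξ ⬝ᵥ w) • ζ + (b * a - 1) • w + (b * m - 1) • ξ + b • (ξ ⨯₃ w) - v1 ⨯₃ ζ‖ ≤
      ‖(1 - a * m + ξ ⬝ᵥ w) • ζ‖ + ‖(b * a - 1) • w‖ + ‖(b * m - 1) • ξ‖ + ‖b • (ξ ⨯₃ w)‖ + ‖v1 ⨯₃ ζ‖ := by
    have e1 := norm_sub_le ((1 - a * m + ξ ⬝ᵥ w) • ζ + (b * a - 1) • w + (b * m - 1) • ξ + b • (ξ ⨯₃ w)) (v1 ⨯₃ ζ)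
    have e2 := norm_add_le ((1 - a * m + ξ ⬝ᵥ w) • ζ + (b * a - 1) • w + (b * m - 1) • ξ) (b • (ξ ⨯₃ w))
    have e3 := norm_add_le ((1 - a * m + ξ ⬝ᵥ w) • ζ + (b * a - 1) • w) ((b * m - 1) • ξ)
    have e4 := norm_add_le ((1 - a * m + ξ ⬝ᵥ w) • ζ) ((b * a - 1) • w)
    linarith only [e1, e2, e3, e4]
  -- replace `‖ξ‖, ‖ζ‖` by `g`
  have hξg2 : ‖ξ‖ ^ 2 ≤ g ^ 2 := pow_le_pow_left₀ hξ0 hgξ 2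
  have hζg2 : ‖ζ‖ ^ 2 ≤ g ^ 2 := pow_le_pow_left₀ hζ0 hgζ 2
  have hU1 : (3 * ‖ξ‖ ^ 2 + 3 * ‖w‖ ^ 2 + 3 * (‖ξ‖ * ‖w‖)) * ‖ζ‖ ≤ (3 * g ^ 2 + 3 * ‖w‖ ^ 2 + 3 * (g * ‖w‖)) * g :=
    by
      have h1 : ‖ξ‖ * ‖w‖ ≤ g * ‖w‖ := mul_le_mul_of_nonneg_right hgξ hw0
      have h2 : 3 * ‖ξ‖ ^ 2 + 3 * ‖w‖ ^ 2 + 3 * (‖ξ‖ * ‖w‖) ≤ 3 * g ^ 2 + 3 * ‖w‖ ^ 2 + 3 * (g * ‖w‖) := by linarith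
      have h3 : 0 ≤ 3 * g ^ 2 + 3 * ‖w‖ ^ 2 + 3 * (g * ‖w‖) := by
        have := mul_nonneg hg0 hw0; have := sq_nonneg g; have := sq_nonneg ‖w‖; linarith
      exact mul_le_mul h2 hgζ hζ0 h3
  have hξw : ‖ξ‖ * ‖w‖ ≤ g * ‖w‖ := mul_le_mul_of_nonneg_right hgξ hw0
  have hgw0 : 0 ≤ g * ‖w‖ := mul_nonneg hg0 hw0
  have hg20 : 0 ≤ g ^ 2 := sq_nonneg g
  have hw20 : 0 ≤ ‖w‖ ^ 2 := sq_nonneg ‖w‖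
  have hU2 : (3 * ‖ζ‖ ^ 2 + 3 * ‖ξ‖ ^ 2) * ‖w‖ ≤ (6 * g ^ 2) * ‖w‖ := mul_le_mul_of_nonneg_right (by linarith) hw0
  have hU3 : (3 * ‖ζ‖ ^ 2 + 3 * ‖w‖ ^ 2) * ‖ξ‖ ≤ (3 * g ^ 2 + 3 * ‖w‖ ^ 2) * g :=
    mul_le_mul (by linarith) hgξ hξ0 (by linarith)
  have hU4 : 2 * (‖ξ‖ * ‖w‖) ≤ 2 * (g * ‖w‖) := by linarith
  have hU5 : 2 * ((‖w‖ + ‖ξ‖ + 2 * (‖ξ‖ * ‖w‖)) * ‖ζ‖) ≤ 2 * ((‖w‖ + g + 2 * (g * ‖w‖)) * g) := by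
    have h1 : ‖w‖ + ‖ξ‖ + 2 * (‖ξ‖ * ‖w‖) ≤ ‖w‖ + g + 2 * (g * ‖w‖) := by linarith
    have h2 : 0 ≤ ‖w‖ + g + 2 * (g * ‖w‖) := by linarith
    have h3 := mul_le_mul h1 hgζ hζ0 h2
    linarith
  -- polynomial endgame with `g, ‖w‖ ≤ 1/4`
  have hx4 : ‖w‖ ≤ 1 / 4 := hw
  have hg3 : g ^ 3 ≤ g ^ 2 * (1 / 4) := by
    rw [pow_succ]; exact mul_le_mul_of_nonneg_left hg4 hg20
  have hx2g : ‖w‖ ^ 2 * g ≤ g * ‖w‖ * (1 / 4) := by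
    rw [show ‖w‖ ^ 2 * g = g * ‖w‖ * ‖w‖ by ring]; exact mul_le_mul_of_nonneg_left hx4 hgw0
  have hg2x : g ^ 2 * ‖w‖ ≤ g * ‖w‖ * (1 / 4) := by
    rw [show g ^ 2 * ‖w‖ = g * ‖w‖ * g by ring]; exact mul_le_mul_of_nonneg_left hg4 hgw0
  calc ‖(1 - a * m + ξ ⬝ᵥ w) • ζ + (b * a - 1) • w + (b * m - 1) • ξ + b • (ξ ⨯₃ w) - v1 ⨯₃ ζ‖
      ≤ (3 * g ^ 2 + 3 * ‖w‖ ^ 2 + 3 * (g * ‖w‖)) * g + (6 * g ^ 2) * ‖w‖ + (3 * g ^ 2 + 3 * ‖w‖ ^ 2) * g + 2 * (g * ‖w‖) +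
          2 * ((‖w‖ + g + 2 * (g * ‖w‖)) * g) := by
        linarith only [hsum, hT1, hT2, hT3, hT4, hT5, hU1, hU2, hU3, hU4, hU5]
    _ = 6 * g ^ 3 + 6 * (‖w‖ ^ 2 * g) + 13 * (g ^ 2 * ‖w‖) + 4 * (g * ‖w‖) + 2 * g ^ 2 := by ring
    _ ≤ 40 * (g ^ 2 + g * ‖w‖) := by linarith only [hg3, hx2g, hg2x, hgw0, hg20]

end Summit.QuantumFields.YangMills.Theorems.FemtoTransferGap.TwoLattice.ConstTube

end
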